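import Literature.NumberTheory.EllipticCurves.HidaFamilyGaloisRepDatum
import Literature.NumberTheory.EllipticCurves.GlobalMinimalModel
import Literature.NumberTheory.EllipticCurves.GreenbergSelmer
import Literature.NumberTheory.EllipticCurves.GeomPointsGaloisModule
import Literature.NumberTheory.EllipticCurves.LocalTorsionMultiplicativeProofs
import Summits.BirchSwinnertonDyer.BirchSwinnertonDyer.Theorems.Rank1ResidualX9Defs
import Mathlib.NumberTheory.Padics.PadicVal.Basic
import HarnessLib

set_option autoImplicit false

-- the summit and its single problem are both named `BirchSwinnertonDyer` (registry layout D-0017)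
set_option linter.dupNamespace false

/-!
# The (U)-ledger of a Hida datum by reduction type — DEFINITIONS
# (helper vocabulary for crux stmt-BirchSwinnertonDyer-20547 `KatoDivisibilityX9`, line `prime_adapted_tau`, stub 3)

Stub 3 of line `prime_adapted_tau` (`stub_goodHidaDatum5S4`; `GoodHidaDatumStructAt`,
`Cruxes/KatoDivisibilityX9/Lines/prime_adapted_tau.lean`) asks, for an X9 pair `(W, p)`, for a Hida datum
`D : HidaFamilyGaloisRepDatum W p 𝕀` with, among other conjuncts, Ochiai's condition
(U) `∀ v ∣ N_W, D.SpecialisationTorsionFreeAt v`.  The bsd-f3-mu cell's kernel-checked sketches (planner-bsd-f3-mu-desc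
g65/g66/g71/g72: `U66.lean` ebe50d703ee9c15b, `Sketch71.lean` v5 f376123484d02b28, glue `P72Check.lean` 5486fa619f6d3e95;
port plan `PORT-PLAN-72.md`) prove the (U) conjunct for EVERY datum over EVERY `𝕀` at every ADDITIVE bad prime
unconditionally and at every SHALLOW MULTIPLICATIVE bad prime (`m_v = v_p(ord_v Δ_min) ≤ 1`) under the construction-side
inputs (Reg) and (W2ℚ_p).  This file holds the VOCABULARY of that ledger (definitions only; the theorems are the sibling
files `…ULedger*.lean`):

* `2 × 2` matrix vocabulary over a commutative ring: `nilMat h = (0 h; 0 0)`, `outerNil e₁ e₂ = e · (−e₂, e₁)`,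
  `EntryMem J A` (all entries of `A` in the ideal `J`);
* datum-level predicates (dot notation on `D : HidaFamilyGaloisRepDatum W p 𝕀`): `D.rhoMat σ` (matrix of `ρ_D(σ)`),
  `D.OneParamInertiaAt v τ`, `D.UnimodularMonodromyAt τ`, `D.MonodromyShallowAt τ`, the ideal `D.specLT` of elements
  topologically nilpotent at the point of `W` (D65-U), `D.PrincipalPointW`;
* curve-level digits: `primeBelow v`, `monodromyDepth W p v = v_p(ord_v Δ_min)`, `ShallowMultiplicativeAt`,
  `DepthOneMultiplicativeAt`, `InertiaFixedPointFreeAt`, `AdditiveFixedPointFree` (on class X9), and the two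
  support statements `TameMonodromyDigitsAt` (desc-S71m) / `TameFamilyMonodromyAt` (desc-S71m°), both THEOREMS in
  the sibling files.

Nothing here is a tree obligation and no ledger item is closed by this vocabulary; BSD is proved for no curve.
References: [Ochiai2006] §3 Lemma 3.2, Cor. 7.5 / Rem. 7.6 (the (U) condition); [Hida1986] p. 559;
[SilvermanATAEC1994] V.4–V.5, Ex. 5.13(b); [SerreAbelianLadic1968] Ch. IV A.1.2.
-/

noncomputable section

open scoped Classical MatrixGroups NumberField
open Matrix IsDedekindDomain Field
open Literature.NumberTheory.EllipticCurves Literature.NumberTheory.GaloisRepresentations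

namespace Summit.BirchSwinnertonDyer.BirchSwinnertonDyer.Theorems.OneSidedTwistSqueezeX9KatoDivisibilityX9ULedger

/-! ## Matrix vocabulary -/

section Matrices

variable {R : Type*} [CommRing R]

/-- The elementary nilpotent `N(h) = (0 h; 0 0)`. -/
def nilMat (h : R) : Matrix (Fin 2) (Fin 2) R := !![0, h; 0, 0]

/-- The rank-one square-zero matrix `e · (−e₂, e₁)` with `e = ᵗ(e₁, e₂)`: entries `e_i · ẽ_j`. -/
def outerNil (e₁ e₂ : R) : Matrix (Fin 2) (Fin 2) R := !![-(e₁ * e₂), e₁ * e₁; -(e₂ * e₂), e₂ * e₁]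

/-- All entries of `A` lie in the ideal `J`. -/
def EntryMem (J : Ideal R) (A : Matrix (Fin 2) (Fin 2) R) : Prop := ∀ a b, A a b ∈ J

end Matrices

end Summit.BirchSwinnertonDyer.BirchSwinnertonDyer.Theorems.OneSidedTwistSqueezeX9KatoDivisibilityX9ULedger

/-! ## Datum-level predicates (dot notation on `HidaFamilyGaloisRepDatum`) -/

namespace Literature.NumberTheory.EllipticCurves.HidaFamilyGaloisRepDatum

open Summit.BirchSwinnertonDyer.BirchSwinnertonDyer.Theorems.OneSidedTwistSqueezeX9KatoDivisibilityX9ULedger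

variable {W : WeierstrassCurve ℚ} {p : ℕ} [Fact p.Prime] {I : Type} [CommRing I] [IsDomain I]
  [IsLocalRing I] [TopologicalSpace I] [IsTopologicalRing I] [Algebra (IwasawaAlgebra p) I]
  (D : HidaFamilyGaloisRepDatum W p I)

/-- The matrix of `ρ_𝓕(σ)` in the datum's frame. -/
abbrev rhoMat (σ : absoluteGaloisGroup ℚ) : Matrix (Fin 2) (Fin 2) I :=
  ((D.rho σ : GL (Fin 2) I) : Matrix (Fin 2) (Fin 2) I)

/-- **(G) ONE-PARAMETER INERTIA at `v` through `τ`** (the conclusion of STEP 1 + STEP 2/3: Ochiai 2006 §3, Lemma 3.2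
and the twist-free form of Thm 3.3 (2)): `τ ∈ I_v` and every `ρ(σ) − 1`, `σ ∈ I_v`, is an `𝕀`-multiple of
`ν := ρ(τ) − 1`.  (For the multiplicative primes of an X9 pair this is STEP 1–2 with `J = I_v`; it is the Galois-side
input this sketch does not formalise.) -/
def OneParamInertiaAt (v : HeightOneSpectrum (𝓞 ℚ)) (τ : absoluteGaloisGroup ℚ) : Prop :=
  τ ∈ GreenbergSelmer.inertia v ∧
    ∀ σ ∈ GreenbergSelmer.inertia v, ∃ s : I, D.rhoMat σ - 1 = s • (D.rhoMat τ - 1)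

/-- **UNIMODULAR MONODROMY at `v`** (case (a) of Lemma 71.2): in some basis of `𝕀²` the monodromy `ν = ρ(τ) − 1` is the
elementary nilpotent `N(h)` with `h ∉ P_W = ker specW` (the monodromy does not die at the point of `W`). -/
def UnimodularMonodromyAt (τ : absoluteGaloisGroup ℚ) : Prop :=
  ∃ B B' : Matrix (Fin 2) (Fin 2) I, B * B' = 1 ∧ B' * B = 1 ∧
    ∃ h : I, h ∉ RingHom.ker D.specW ∧ D.rhoMat τ - 1 = B * nilMat h * B'

/-- **THE ONE-POINT TEST (output of Lemma 71.3; paper).**  In any normal form of the monodromy at `τ`, the primitive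
direction is UNIMODULAR (a unit coordinate — over the local ring `𝕀`: not both coordinates in `𝔪`) and the length
`h` does not die at the point of `W`.  PAPER PROOF under `(Reg) ∧ (W2ℚ_p) ∧ m_v = 1`: `specW(ν) = P (A_τ − 1) P⁻¹`
with `P` integral ((v) `exists_conj_galoisRepTate`), content valuations agree, `c(A_τ − 1) = m_v = 1`, while both
`e_i ∈ 𝔪` would give `c(specW ν) = v(specW h) + 2·min v(specW e_i) ≥ 2` (`specW` is a local map, D65-U
`isUnit_iff_norm_specW_eq_one`; values in `ℤ_p` by `(W2ℚ_p)`). -/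
def MonodromyShallowAt (τ : absoluteGaloisGroup ℚ) : Prop :=
  ∀ h e₁ e₂ : I, D.rhoMat τ - 1 = h • outerNil e₁ e₂ → IsRelPrime e₁ e₂ →
    (IsUnit e₁ ∨ IsUnit e₂) ∧ h ∉ RingHom.ker D.specW

/-- The elements of `𝕀` whose value at the point of `W` is topologically nilpotent. -/
def specLT : Ideal I where
  carrier := {x | ‖D.specW x‖ < 1}
  zero_mem' := by simp
  add_mem' := by
    intro a b ha hb
    simp only [Set.mem_setOf_eq, map_add] at ha hb ⊢
    exact lt_of_le_of_lt (PadicAlgCl.isNonarchimedean p _ _) (max_lt ha hb)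
  smul_mem' := by
    intro c x hx
    simp only [Set.mem_setOf_eq, smul_eq_mul, map_mul, norm_mul] at hx ⊢
    exact mul_lt_one_of_nonneg_of_lt_one_right (D.norm_specW_le_one c) (norm_nonneg _) hx

/-- Membership in `D.specLT`: `‖specW x‖ < 1`. -/
theorem mem_specLT {x : I} : x ∈ D.specLT ↔ ‖D.specW x‖ < 1 :=
  Iff.rfl

end Literature.NumberTheory.EllipticCurves.HidaFamilyGaloisRepDatum

namespace Literature.NumberTheory.EllipticCurves.HidaFamilyGaloisRepDatum

/-- **`P_W` principal** (construction-side residual; commutative algebra under (Reg): `𝕀 ≅ 𝒪⟦X⟧` is factorial of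
dimension `2` and `P_W = ker specW` is a prime `≠ 0, ≠ 𝔪_𝕀`, hence of height one, hence principal). -/
def PrincipalPointW {W : WeierstrassCurve ℚ} {p : ℕ} [Fact p.Prime] {I : Type} [CommRing I] [IsDomain I]
    [IsLocalRing I] [TopologicalSpace I] [IsTopologicalRing I] [Algebra (IwasawaAlgebra p) I]
    (D : HidaFamilyGaloisRepDatum W p I) : Prop :=
  ∃ ϖ : I, Prime ϖ ∧ RingHom.ker D.specW = Ideal.span {ϖ}

end Literature.NumberTheory.EllipticCurves.HidaFamilyGaloisRepDatum

/-! ## Curve-level digits and the two support statements -/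

namespace Summit.BirchSwinnertonDyer.BirchSwinnertonDyer.Theorems.OneSidedTwistSqueezeX9KatoDivisibilityX9ULedger

open Literature.NumberTheory.EllipticCurves.HidaFamilyGaloisRepDatum
open NumberField WeierstrassCurve
open Summit.BirchSwinnertonDyer.BirchSwinnertonDyer.Rank1Residual

/-- The rational prime under the finite place `v` of `ℚ`. -/
abbrev primeBelow (v : HeightOneSpectrum (𝓞 ℚ)) : ℕ :=
  ((Rat.HeightOneSpectrum.primesEquiv v : Nat.Primes) : ℕ)

/-- `m_v(W,p) := v_p(ord_v Δ_min(W))`, the `p`-part of the component-group order at a multiplicative `v`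
(`= v_p(c_v)` at split `v`).  On an X9 pair `m_v ≥ 1` at every multiplicative `v` (`ρ̄_{W,p}` unramified at `v`). -/
noncomputable def monodromyDepth (W : WeierstrassCurve ℚ) [W.IsGloballyMinimal] (p : ℕ)
    (v : HeightOneSpectrum (𝓞 ℚ)) : ℕ :=
  padicValNat p (padicValInt (primeBelow v) (minimalDiscriminantInt W))

/-- **SHALLOW multiplicative prime**: `v ∥ N_W` and `p² ∤ ord_v Δ_min`.  Census D71: all 374 multiplicative primes of
the 790 X9 rows are shallow (`ord_v Δ_min ∈ {5, 10, 15}` at `p = 5`, `= 7` at `p = 7`); deep ones (`m_v ≥ 2`): 0. -/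
def ShallowMultiplicativeAt (W : WeierstrassCurve ℚ) [W.IsGloballyMinimal] (p : ℕ)
    (v : HeightOneSpectrum (𝓞 ℚ)) : Prop :=
  W.HasMultiplicativeReductionAt v ∧ monodromyDepth W p v ≤ 1

/-- **DEPTH-ONE multiplicative prime**: `v ∥ N_W` and `m_v = v_p(ord_v Δ_min) = 1` EXACTLY — the census value at
all 374 multiplicative primes of the 790 X9 rows (D71-ULEDGER-v1: `ord_v Δ_min ∈ {5, 10, 15}` at `p = 5`, `= 7` at
`p = 7`).  Implies `ShallowMultiplicativeAt`. -/
def DepthOneMultiplicativeAt (W : WeierstrassCurve ℚ) [W.IsGloballyMinimal] (p : ℕ)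
    (v : HeightOneSpectrum (𝓞 ℚ)) : Prop :=
  W.HasMultiplicativeReductionAt v ∧ monodromyDepth W p v = 1

/-- **`I_v` has a fixed-point-free element on `E[p]`**: some `σ` in the tree's inertia group at `v`
fixes no non-zero `p`-torsion point.  (W-side, checkable statement; at an additive `v ∤ p` of an X9 pair it
is classical — `AdditiveFixedPointFree` below.) -/
def InertiaFixedPointFreeAt (W : WeierstrassCurve ℚ) (p : ℕ) (v : HeightOneSpectrum (𝓞 ℚ)) : Prop :=
  ∃ σ ∈ GreenbergSelmer.inertia (K := ℚ) v, ∀ Q : W.geomTorsion (p : ℤ), σ • Q = Q → Q = 0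

/-- **desc-S71 (support, classical; class-wide, not table-bound).**  On class X9, at every additive prime
`v` (necessarily `v ≠ p`): `I_v` has a fixed-point-free element on `E[p]`.  Paper proof: the tree's
`WeierstrassCurve.exists_inertia_smul_ne_of_hasAdditiveReductionAt` (Silverman AEC VII.6.1/VII.7.1: some
inertia element MOVES a `p`-torsion point, `p ≥ 3`) gives `σ ∈ I_v` with `ρ̄(σ) ≠ 1`; `det ρ̄|I_v = 1`
(`v ≠ p`); on X9 the image `ρ̄(Γ_ℚ)` is a `p'`-group (Dickson: an irreducible proper subgroup of
`GL₂(𝔽_p)` not containing `SL₂` lies in a Cartan normaliser or is exceptional), so `ρ̄(σ)` is semisimple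
with eigenvalues `ζ^{±1}`, `ζ ≠ 1`, i.e. `ρ̄(σ) − 1` is invertible. -/
def AdditiveFixedPointFree (W : WeierstrassCurve ℚ) [W.IsElliptic] [W.IsGloballyMinimal] (p : ℕ)
    [Fact p.Prime] : Prop :=
  ClassX9 W p → ∀ v : HeightOneSpectrum (𝓞 ℚ), primeBelow v ∣ W.conductorNorm ℤ →
    W.HasAdditiveReductionAt v → InertiaFixedPointFreeAt W p v

/-- **desc-S71m — TAME MONODROMY DIGITS at `v`** (residual support; classical at a SHALLOW multiplicative prime
`v ∤ p` of an X9 pair, `p ≥ 5` — PAPER: Tate curve + structure of tame inertia): there are `τ ∈ I_v`, `φ ∈ Γ_ℚ`,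
`ℓ ≥ 2` with the `E`-DIGITS «`ρ_W(τ)` unipotent on `T_p W`» (`det = 1`, `tr = 2`) and «not `p²`-deep»
(`ρ_W(τ) − 1 ∉ p² End T_p W`, i.e. `m_v = ord_p(ord_v Δ_min) ≤ 1`), and, for EVERY datum `D`, one-parameter
inertia through `τ` and the tame relation `ρ_D(φ τ φ⁻¹) = ρ_D(τ^ℓ)` (`ρ_D|I_v` factors through
`t_p : I_v ↠ ℤ_p(1)` since `ρ̄_W(I_v) = 1` and `1 + M₂(𝔪_𝕀)` is pro-`p`; `τ ↦` a generator, `φ` a Frobenius lift,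
`ℓ = N(v)`). -/
def TameMonodromyDigitsAt (W : WeierstrassCurve ℚ) (p : ℕ) [Fact p.Prime] (v : HeightOneSpectrum (𝓞 ℚ)) :
    Prop :=
  ∃ τ φ : absoluteGaloisGroup ℚ, ∃ ℓ : ℕ, 2 ≤ ℓ ∧
    LinearMap.det (W.galoisRepTate p τ) = 1 ∧ LinearMap.trace ℤ_[p] _ (W.galoisRepTate p τ) = 2 ∧
    (∀ g : Module.End ℤ_[p] (W.tateModule p), W.galoisRepTate p τ - 1 ≠ ((p : ℤ_[p]) ^ 2) • g) ∧
    ∀ (I : Type) (_ : CommRing I) (_ : IsDomain I) (_ : IsLocalRing I) (_ : TopologicalSpace I)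
      (_ : IsTopologicalRing I) (_ : Algebra (IwasawaAlgebra p) I) (D : HidaFamilyGaloisRepDatum W p I),
      D.OneParamInertiaAt v τ ∧ D.rhoMat (φ * τ * φ⁻¹) = D.rhoMat (τ ^ ℓ)

/-- **desc-S71m° — TAME FAMILY MONODROMY AT A STEINBERG PRIME (classical support; deformation side only).**
At a multiplicative `v ∤ p` of `W` with `p ∣ ord_v Δ_min` (so `ρ̄_{W,p}(I_v) = 1`), every `τ ∈ I_v` that is unipotent
on `T_p W` and moves `W[p²]` is a topological generator of the tame `ℤ_p(1)`-quotient through which `ρ_D|I_v`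
factors for EVERY datum `D` (arithmetic specialisations are Steinberg twists at `v` by local–global compatibility,
so `(ρ_D(τ) − 1)² = 0` and `ρ_D(σ) = ρ_D(τ)^{t_p(σ)/t_p(τ)} = 1 + a_σ (ρ_D(τ) − 1)` by density (v)); a Frobenius lift
`φ` gives the tame relation with `ℓ = N(v) ≥ 2`.  Paper support: Carayol 1986 (local–global compatibility `ℓ ≠ p`),
Hida 1986 (constancy of tame level), field (v) `dense_arithPoints`.
[cite: Hida1986, p. 559] [cite: SerreAbelianLadic1968, Ch. IV, A.1.2] -/
def TameFamilyMonodromyAt (W : WeierstrassCurve ℚ) [W.IsElliptic] (p : ℕ) [Fact p.Prime]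
    (v : HeightOneSpectrum (𝓞 ℚ)) : Prop :=
  W.HasMultiplicativeReductionAt v → (p : 𝓞 ℚ) ∉ v.asIdeal → p ∣ W.ordMinimalDiscriminant v →
    ∀ τ ∈ GreenbergSelmer.inertia (K := ℚ) v,
      (W.galoisRepTate p τ - 1) * (W.galoisRepTate p τ - 1) = 0 →
      (∃ Q : geomTorsion W ((p ^ 2 : ℕ) : ℤ), τ • Q ≠ Q) →
      ∃ φ : absoluteGaloisGroup ℚ, ∃ ℓ : ℕ, 2 ≤ ℓ ∧
        ∀ (I : Type) (_ : CommRing I) (_ : IsDomain I) (_ : IsLocalRing I) (_ : TopologicalSpace I)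
          (_ : IsTopologicalRing I) (_ : Algebra (IwasawaAlgebra p) I) (D : HidaFamilyGaloisRepDatum W p I),
          D.OneParamInertiaAt v τ ∧ D.rhoMat (φ * τ * φ⁻¹) = D.rhoMat (τ ^ ℓ)

end Summit.BirchSwinnertonDyer.BirchSwinnertonDyer.Theorems.OneSidedTwistSqueezeX9KatoDivisibilityX9ULedger
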